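import Mathlib.Analysis.InnerProductSpace.Basic
import Mathlib.Analysis.InnerProductSpace.PiL2
import Mathlib.Analysis.Matrix.Order
import Mathlib.Analysis.SpecialFunctions.ContinuousFunctionalCalculus.Rpow.Basic
import Literature.NumberTheory.LFunctions.Zhang2022.KnifeEdgeLenZDegreeMinors

/-!
# Zhang (2022), rung F-S3 (Landau–Siegel programme, §D edge len = E*-len⁺): route `ZDegreeToeplitzBand`, item α3 / the barrier
# horn — GRAM TABLES ARE PSD: if the three tables and the three main-term forms of an in-class triple are the inner products of three
# vectors in some inner-product space, the graded main matrix is positive semidefinite; class-wide, `GradedPSD` (PROVED)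

Y. Zhang, *Discrete mean estimates and the Landau–Siegel zero*, arXiv:2211.02515v1 [Zhang2022LandauSiegel] — an
unrefereed manuscript under adjudication. **WHAT THIS IS NOT: not a claim about Theorems 1–2 of arXiv:2211.02515, about
Landau–Siegel zeros, or about Parity. The programme SEARCHES and TYPES; no claim about Landau–Siegel zeros, Theorems 1–2 of
arXiv:2211.02515 or a repaired Margin232 until a kernel theorem says so.** Nothing is asserted about the route's tables; this is
the kernel form of the mechanism by which the route's LIKELY PRODUCT arises (Route.md Kill criteria; referee ls-ref-1's
ALPHA3-CELL v0.3 stage S1: «agreement [with the ⟨A⟩-lattice model] ⇒ the 3×3 `gradedMainMatrix` is a model Gram matrix ⇒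
`GradedPSD` (barrier horn, B-AH/E-014 prediction) is the product»): a table triple that is a GRAM triple — `𝔅(f) = ⟪v₀,v₀⟫`,
`𝔅(g₁) = ⟪v₁,v₁⟫`, `𝔅(g₂) = ⟪v₂,v₂⟫`, `X₁(f,g₁) = ⟪v₁,v₀⟫`, `Y₁(g₁,g₂) = ⟪v₂,v₁⟫`, `X₂(f,g₂) = ⟪v₂,v₀⟫` for vectors
`v₀(f), v₁(g₁), v₂(g₂)` of one inner-product space (the continued-calculus / limit-of-Gram picture of registry row E-014) — can
never close: `x⋆Mx = ‖Σ x_a v_a‖² ≥ 0`. So item α3 `GradedCloses X₁ψ Y₁ψ X₂ψ` REQUIRES the census tables to deviate from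
every Gram representation on some in-class triple (e.g. one Cauchy–Schwarz violation, `gradedCloses_of_minor02`).

## References
* Y. Zhang, arXiv:2211.02515v1 (2022), §2 (2.16)–(2.17), §7 Prop. 7.1 (7.2). [cite: Zhang2022LandauSiegel, §2 (2.16)–(2.17), §7 Prop 7.1 (7.2)]
-/

noncomputable section

open Complex Real ComplexConjugate Matrix
open scoped ComplexOrder InnerProductSpace

namespace Literature.NumberTheory.LFunctions.Zhang2022.KnifeEdge

open Repair Skeleton

section Gram

variable {E : Type*} [NormedAddCommGroup E] [InnerProductSpace ℂ E]
variable {X₁ Y₁ X₂ : PairFunctional} {f f' g₁ g₁' g₂ g₂' : ℝ → ℂ}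

/-- For a matrix of inner products `M_ab = ⟪v_a, v_b⟫`, the Hermitian form is a norm square: `x⋆Mx = ⟪Σ x_a v_a, Σ x_b v_b⟫`.
[cite: Zhang2022LandauSiegel, §2 (2.16)–(2.17)] -/
theorem star_dotProduct_mulVec_of_gram (v : Fin 3 → E) {M : Matrix (Fin 3) (Fin 3) ℂ} (hM : ∀ a b, M a b = ⟪v a, v b⟫_ℂ)
    (x : Fin 3 → ℂ) : star x ⬝ᵥ (M *ᵥ x) = ⟪∑ a, x a • v a, ∑ b, x b • v b⟫_ℂ := by
  simp only [dotProduct, Matrix.mulVec, Pi.star_apply, Complex.star_def, Finset.mul_sum, sum_inner, inner_sum,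
    inner_smul_left, inner_smul_right, hM]
  conv_rhs => rw [Finset.sum_comm]
  refine Finset.sum_congr rfl fun a _ => Finset.sum_congr rfl fun b _ => ?_
  ring

/-- **A Gram main matrix is PSD (proved):** if `gradedMainMatrix X₁ Y₁ X₂ f f′ g₁ g₁′ g₂ g₂′ a b = ⟪v a, v b⟫` for three vectors
`v : Fin 3 → E`, it is positive semidefinite. [cite: Zhang2022LandauSiegel, §2 (2.16)–(2.17)] -/
theorem posSemidef_gradedMainMatrix_of_gram (v : Fin 3 → E)
    (hM : ∀ a b, gradedMainMatrix X₁ Y₁ X₂ f f' g₁ g₁' g₂ g₂' a b = ⟪v a, v b⟫_ℂ) :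
    (gradedMainMatrix X₁ Y₁ X₂ f f' g₁ g₁' g₂ g₂').PosSemidef := by
  refine Matrix.PosSemidef.of_dotProduct_mulVec_nonneg (gradedMainMatrix_isHermitian X₁ Y₁ X₂ f f' g₁ g₁' g₂ g₂') fun x => ?_
  rw [star_dotProduct_mulVec_of_gram v hM x, inner_self_eq_norm_sq_to_K, ← RCLike.ofReal_pow]
  exact RCLike.ofReal_nonneg.mpr (sq_nonneg _)

/-- **The six Gram identities give the whole matrix** (the upper triangle by conjugate symmetry `inner_conj_symm`): it suffices
that `𝔅(f) = ⟪v₀,v₀⟫`, `𝔅(g₁) = ⟪v₁,v₁⟫`, `𝔅(g₂) = ⟪v₂,v₂⟫`, `X₁(f,g₁) = ⟪v₁,v₀⟫`, `Y₁(g₁,g₂) = ⟪v₂,v₁⟫`, `X₂(f,g₂) = ⟪v₂,v₀⟫`.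
[cite: Zhang2022LandauSiegel, §2 (2.16)–(2.17)] -/
theorem gradedMainMatrix_eq_gram (v : Fin 3 → E) (h0 : (mainTermForm f f' : ℂ) = ⟪v 0, v 0⟫_ℂ)
    (h1 : (mainTermForm g₁ g₁' : ℂ) = ⟪v 1, v 1⟫_ℂ) (h2 : (mainTermForm g₂ g₂' : ℂ) = ⟪v 2, v 2⟫_ℂ)
    (hX₁ : X₁ f f' g₁ g₁' = ⟪v 1, v 0⟫_ℂ) (hY₁ : Y₁ g₁ g₁' g₂ g₂' = ⟪v 2, v 1⟫_ℂ) (hX₂ : X₂ f f' g₂ g₂' = ⟪v 2, v 0⟫_ℂ) :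
    ∀ a b, gradedMainMatrix X₁ Y₁ X₂ f f' g₁ g₁' g₂ g₂' a b = ⟪v a, v b⟫_ℂ := by
  intro a b
  fin_cases a <;> fin_cases b <;>
    simp [gradedMainMatrix, h0, h1, h2, hX₁, hY₁, hX₂, inner_conj_symm]

/-- **GRAM TABLES NEVER CLOSE (proved): the barrier horn from a Gram representation.** If on every in-class triple the three main
forms and the three tables are the inner products of three vectors of ONE inner-product space `E` (the continued-calculus /
model-Gram picture of E-014, the route's likely product), then `GradedPSD X₁ Y₁ X₂` — hence `¬ GradedCloses X₁ Y₁ X₂`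
(`not_gradedCloses_of_gradedPSD`). Item α3 therefore needs the census tables to LEAVE every Gram representation on some triple.
[cite: Zhang2022LandauSiegel, §2 (2.16)–(2.17), §7 Prop 7.1 (7.2)] -/
theorem gradedPSD_of_gram
    (h : ∀ (f f' g₁ g₁' g₂ g₂' : ℝ → ℂ), InClassPiece f f' → InClassPiece g₁ g₁' → InClassPiece g₂ g₂' →
      ∃ v : Fin 3 → E, (mainTermForm f f' : ℂ) = ⟪v 0, v 0⟫_ℂ ∧ (mainTermForm g₁ g₁' : ℂ) = ⟪v 1, v 1⟫_ℂ ∧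
        (mainTermForm g₂ g₂' : ℂ) = ⟪v 2, v 2⟫_ℂ ∧ X₁ f f' g₁ g₁' = ⟪v 1, v 0⟫_ℂ ∧ Y₁ g₁ g₁' g₂ g₂' = ⟪v 2, v 1⟫_ℂ ∧
        X₂ f f' g₂ g₂' = ⟪v 2, v 0⟫_ℂ) :
    GradedPSD X₁ Y₁ X₂ := by
  intro f f' g₁ g₁' g₂ g₂' hf hg₁ hg₂
  obtain ⟨v, h0, h1, h2, hX₁, hY₁, hX₂⟩ := h f f' g₁ g₁' g₂ g₂' hf hg₁ hg₂
  exact posSemidef_gradedMainMatrix_of_gram v (gradedMainMatrix_eq_gram v h0 h1 h2 hX₁ hY₁ hX₂)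

/-- … and so no design closes. [cite: Zhang2022LandauSiegel, §2 (2.16)] -/
theorem not_gradedCloses_of_gram
    (h : ∀ (f f' g₁ g₁' g₂ g₂' : ℝ → ℂ), InClassPiece f f' → InClassPiece g₁ g₁' → InClassPiece g₂ g₂' →
      ∃ v : Fin 3 → E, (mainTermForm f f' : ℂ) = ⟪v 0, v 0⟫_ℂ ∧ (mainTermForm g₁ g₁' : ℂ) = ⟪v 1, v 1⟫_ℂ ∧
        (mainTermForm g₂ g₂' : ℂ) = ⟪v 2, v 2⟫_ℂ ∧ X₁ f f' g₁ g₁' = ⟪v 1, v 0⟫_ℂ ∧ Y₁ g₁ g₁' g₂ g₂' = ⟪v 2, v 1⟫_ℂ ∧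
        X₂ f f' g₂ g₂' = ⟪v 2, v 0⟫_ℂ) :
    ¬ GradedCloses X₁ Y₁ X₂ :=
  not_gradedCloses_of_gradedPSD (gradedPSD_of_gram h)

end Gram

/-! ### Part 2 — (a) the CONVERSE at `E = ℂ³` (critic ls-knife-crit-1 g3 probe `GramConverse-ZDegreeToeplitzBand.lean` f5a964f67de474ef,
folded verbatim): a PSD Hermitian `3×3` matrix is a Gram matrix, so a Gram representation chosen PER TRIPLE is `GradedPSD` itself and carries
no further information; (b) the certificate that DOES carry information — a UNIFORM FEATURE MAP, one map per leg, independent of the triple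
(e.g. a common kernel / the `kernelPair` shapes in one `L²`-space): `gradedPSD_of_featureMap`. -/

section Converse

open scoped MatrixOrder

variable {X₁ Y₁ X₂ : PairFunctional}

/-- A positive-semidefinite complex `3×3` matrix is the Gram matrix of three vectors of `ℂ³` (the columns of its PSD square root).
[folklore] -/
private theorem exists_gram_of_posSemidef {M : Matrix (Fin 3) (Fin 3) ℂ} (hM : M.PosSemidef) :
    ∃ v : Fin 3 → EuclideanSpace ℂ (Fin 3), ∀ a b, M a b = ⟪v a, v b⟫_ℂ := by
  have hB0 : 0 ≤ CFC.sqrt M := CFC.sqrt_nonneg M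
  have hBB : CFC.sqrt M * CFC.sqrt M = M := CFC.sqrt_mul_sqrt_self M hM.nonneg
  have hBh : (CFC.sqrt M)ᴴ = CFC.sqrt M := hB0.posSemidef.1
  refine ⟨fun a => WithLp.toLp 2 (fun i => CFC.sqrt M i a), fun a b => ?_⟩
  rw [EuclideanSpace.inner_toLp_toLp]
  conv_lhs => rw [← hBB]
  rw [Matrix.mul_apply]
  simp only [dotProduct, Pi.star_apply]
  refine Finset.sum_congr rfl fun i _ => ?_
  have h1 : star (CFC.sqrt M i a) = CFC.sqrt M a i := by
    have := congrFun (congrFun hBh a) i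
    rwa [conjTranspose_apply] at this
  rw [h1]; ring

/-- **Converse of `gradedPSD_of_gram` with `E = ℂ³` (proved):** `GradedPSD` ⇒ a per-triple Gram representation (six identities).
[cite: Zhang2022LandauSiegel, §2 (2.16)–(2.17)] -/
theorem gram_of_gradedPSD (hP : GradedPSD X₁ Y₁ X₂) :
    ∀ (f f' g₁ g₁' g₂ g₂' : ℝ → ℂ), InClassPiece f f' → InClassPiece g₁ g₁' → InClassPiece g₂ g₂' →
      ∃ v : Fin 3 → EuclideanSpace ℂ (Fin 3), (mainTermForm f f' : ℂ) = ⟪v 0, v 0⟫_ℂ ∧ (mainTermForm g₁ g₁' : ℂ) = ⟪v 1, v 1⟫_ℂ ∧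
        (mainTermForm g₂ g₂' : ℂ) = ⟪v 2, v 2⟫_ℂ ∧ X₁ f f' g₁ g₁' = ⟪v 1, v 0⟫_ℂ ∧ Y₁ g₁ g₁' g₂ g₂' = ⟪v 2, v 1⟫_ℂ ∧
        X₂ f f' g₂ g₂' = ⟪v 2, v 0⟫_ℂ := by
  intro f f' g₁ g₁' g₂ g₂' hf hg₁ hg₂
  obtain ⟨v, hv⟩ := exists_gram_of_posSemidef (hP f f' g₁ g₁' g₂ g₂' hf hg₁ hg₂)
  refine ⟨v, ?_, ?_, ?_, ?_, ?_, ?_⟩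
  · simpa [gradedMainMatrix] using hv 0 0
  · simpa [gradedMainMatrix] using hv 1 1
  · simpa [gradedMainMatrix] using hv 2 2
  · simpa [gradedMainMatrix] using hv 1 0
  · simpa [gradedMainMatrix] using hv 2 1
  · simpa [gradedMainMatrix] using hv 2 0

/-- **Per-triple Gram representations are `GradedPSD` itself (proved):** the hypothesis of `gradedPSD_of_gram` at `E = ℂ³` ⟺
`GradedPSD X₁ Y₁ X₂`. So the referee's S1′ certificate must be UNIFORM in the triple (`gradedPSD_of_featureMap`) to say more than a PSD
check. [cite: Zhang2022LandauSiegel, §2 (2.16)–(2.17)] -/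
theorem gradedPSD_iff_gram3 :
    GradedPSD X₁ Y₁ X₂ ↔
    ∀ (f f' g₁ g₁' g₂ g₂' : ℝ → ℂ), InClassPiece f f' → InClassPiece g₁ g₁' → InClassPiece g₂ g₂' →
      ∃ v : Fin 3 → EuclideanSpace ℂ (Fin 3), (mainTermForm f f' : ℂ) = ⟪v 0, v 0⟫_ℂ ∧ (mainTermForm g₁ g₁' : ℂ) = ⟪v 1, v 1⟫_ℂ ∧
        (mainTermForm g₂ g₂' : ℂ) = ⟪v 2, v 2⟫_ℂ ∧ X₁ f f' g₁ g₁' = ⟪v 1, v 0⟫_ℂ ∧ Y₁ g₁ g₁' g₂ g₂' = ⟪v 2, v 1⟫_ℂ ∧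
        X₂ f f' g₂ g₂' = ⟪v 2, v 0⟫_ℂ :=
  ⟨gram_of_gradedPSD, gradedPSD_of_gram⟩

end Converse

section FeatureMap

variable {E : Type*} [NormedAddCommGroup E] [InnerProductSpace ℂ E]
variable {X₁ Y₁ X₂ : PairFunctional}

/-- **The UNIFORM Gram certificate (feature maps, one per leg; proved):** if there are maps `Φ₀, Φ₁, Φ₂` from profile pieces
`(g, g′)` to ONE inner-product space `E`, each `𝔅`-isometric on in-class pieces (`𝔅(g) = ‖Φ_a g‖²`, the SAME diagonal on all three
legs), with `X₁(f,g₁) = ⟪Φ₁ g₁, Φ₀ f⟫`, `Y₁(g₁,g₂) = ⟪Φ₂ g₂, Φ₁ g₁⟫`, `X₂(f,g₂) = ⟪Φ₂ g₂, Φ₀ f⟫` for all in-class pieces, then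
`GradedPSD X₁ Y₁ X₂` — the continued-calculus / model-Gram mechanism of the route's LIKELY PRODUCT in its informative form (a common
kernel; cf. the `kernelPair` shapes of `KnifeEdgeLenZDegreeKernels`). [cite: Zhang2022LandauSiegel, §2 (2.16)–(2.17), §7 Prop 7.1 (7.2)] -/
theorem gradedPSD_of_featureMap (Φ₀ Φ₁ Φ₂ : (ℝ → ℂ) → (ℝ → ℂ) → E)
    (hB₀ : ∀ g g' : ℝ → ℂ, InClassPiece g g' → (mainTermForm g g' : ℂ) = ⟪Φ₀ g g', Φ₀ g g'⟫_ℂ)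
    (hB₁ : ∀ g g' : ℝ → ℂ, InClassPiece g g' → (mainTermForm g g' : ℂ) = ⟪Φ₁ g g', Φ₁ g g'⟫_ℂ)
    (hB₂ : ∀ g g' : ℝ → ℂ, InClassPiece g g' → (mainTermForm g g' : ℂ) = ⟪Φ₂ g g', Φ₂ g g'⟫_ℂ)
    (hX₁ : ∀ f f' g g' : ℝ → ℂ, InClassPiece f f' → InClassPiece g g' → X₁ f f' g g' = ⟪Φ₁ g g', Φ₀ f f'⟫_ℂ)
    (hY₁ : ∀ g₁ g₁' g₂ g₂' : ℝ → ℂ, InClassPiece g₁ g₁' → InClassPiece g₂ g₂' → Y₁ g₁ g₁' g₂ g₂' = ⟪Φ₂ g₂ g₂', Φ₁ g₁ g₁'⟫_ℂ)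
    (hX₂ : ∀ f f' g g' : ℝ → ℂ, InClassPiece f f' → InClassPiece g g' → X₂ f f' g g' = ⟪Φ₂ g g', Φ₀ f f'⟫_ℂ) :
    GradedPSD X₁ Y₁ X₂ :=
  gradedPSD_of_gram fun f f' g₁ g₁' g₂ g₂' hf hg₁ hg₂ =>
    ⟨![Φ₀ f f', Φ₁ g₁ g₁', Φ₂ g₂ g₂'], by simpa using hB₀ f f' hf, by simpa using hB₁ g₁ g₁' hg₁,
      by simpa using hB₂ g₂ g₂' hg₂, by simpa using hX₁ f f' g₁ g₁' hf hg₁, by simpa using hY₁ g₁ g₁' g₂ g₂' hg₁ hg₂,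
      by simpa using hX₂ f f' g₂ g₂' hf hg₂⟩

/-- … so with a uniform feature map no design closes, and (contrapositive) a closing design rules out EVERY such feature map.
[cite: Zhang2022LandauSiegel, §2 (2.16)] -/
theorem not_gradedCloses_of_featureMap (Φ₀ Φ₁ Φ₂ : (ℝ → ℂ) → (ℝ → ℂ) → E)
    (hB₀ : ∀ g g' : ℝ → ℂ, InClassPiece g g' → (mainTermForm g g' : ℂ) = ⟪Φ₀ g g', Φ₀ g g'⟫_ℂ)
    (hB₁ : ∀ g g' : ℝ → ℂ, InClassPiece g g' → (mainTermForm g g' : ℂ) = ⟪Φ₁ g g', Φ₁ g g'⟫_ℂ)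
    (hB₂ : ∀ g g' : ℝ → ℂ, InClassPiece g g' → (mainTermForm g g' : ℂ) = ⟪Φ₂ g g', Φ₂ g g'⟫_ℂ)
    (hX₁ : ∀ f f' g g' : ℝ → ℂ, InClassPiece f f' → InClassPiece g g' → X₁ f f' g g' = ⟪Φ₁ g g', Φ₀ f f'⟫_ℂ)
    (hY₁ : ∀ g₁ g₁' g₂ g₂' : ℝ → ℂ, InClassPiece g₁ g₁' → InClassPiece g₂ g₂' → Y₁ g₁ g₁' g₂ g₂' = ⟪Φ₂ g₂ g₂', Φ₁ g₁ g₁'⟫_ℂ)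
    (hX₂ : ∀ f f' g g' : ℝ → ℂ, InClassPiece f f' → InClassPiece g g' → X₂ f f' g g' = ⟪Φ₂ g g', Φ₀ f f'⟫_ℂ) :
    ¬ GradedCloses X₁ Y₁ X₂ :=
  not_gradedCloses_of_gradedPSD (gradedPSD_of_featureMap Φ₀ Φ₁ Φ₂ hB₀ hB₁ hB₂ hX₁ hY₁ hX₂)

end FeatureMap

end Literature.NumberTheory.LFunctions.Zhang2022.KnifeEdge

end
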